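import Mathlib.NumberTheory.Chebyshev
import HarnessLib

/-!
# AKS primality: existence of a small modulus `r` with large order (AKS 2004, Lemma 4.3)

[AKS04, Lemma 4.3] shows that for `n ≥ 2` some `r ≤ max {3, ⌈log⁵ n⌉}` has `o_r(n) > log² n`,
using Nair's bound `lcm(1, …, m) ≥ 2 ^ m` (`m ≥ 7`, [AKS04, Lemma 3.1]). We prove the version the
algorithm uses, with integer bookkeeping and Mathlib's Chebyshev-type bound
`2 ^ m ≤ (m + 1) · lcm(1, …, m)` (`Chebyshev.two_pow_le_mul_lcmUpto`) in place of Nair's: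

* `AKS.rBound L = 2 L⁵ + 8` — the search bound, `L` any exponent with `n < 2 ^ L`;
* `AKS.exists_r_le`: for `2 ≤ n < 2 ^ L` there is `2 ≤ r ≤ rBound L` such that
  `r ∤ n ^ k - 1` for all `1 ≤ k ≤ L ^ 2` (so `o_r(n) > L ^ 2` whenever `(n, r) = 1`);
  `AKS.exists_r_le'` — the same with `n ^ k % r ≠ 1`.

Proof [AKS04, p. 785]: otherwise every `r ≤ rBound L` divides `∏_{k ≤ L²} (n ^ k - 1) < 2 ^ (L⁵)`,
hence so does `lcm(1, …, rBound L) ≥ 2 ^ (rBound L) / (rBound L + 1)`, which is absurd. Unlike the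
printed lemma we do not divide out `(s, n)` (the step corrected in the 2019 erratum): the AKS
algorithm of `AKSAlgorithm.lean` trial-divides up to `rBound L` first, so coprimality of the `r`
found is automatic there, and the statement here needs no coprimality at all.

## References

* [AKS04] M. Agrawal, N. Kayal, N. Saxena, *PRIMES is in P*, Ann. of Math. 160 (2004) 781–793,
  Lemma 3.1, Lemma 4.3 (held: `doi:10.4007/annals.2004.160.781`, pp. 784–785); Erratum, Ann. of
  Math. 189 (2019) 317–318.
* M. Nair, *On Chebyshev-type inequalities for primes*, Amer. Math. Monthly 89 (1982) 126–129.
-/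

namespace Literature.NumberTheory.Primality

open Finset

namespace AKS

/-- The search bound for the modulus `r` of the AKS test in terms of an exponent `L` with
`n < 2 ^ L` (the paper's `⌈log⁵ n⌉`, here `2 L⁵ + 8` to absorb the factor `m + 1` of the
binomial lcm bound). [cite: AgrawalKayalSaxena2004, Lemma 4.3] -/
def rBound (L : ℕ) : ℕ := 2 * L ^ 5 + 8

/-- `rBound L + 1 ≤ 2 ^ (L ^ 5 + 8)`, the elementary inequality closing the counting. [folklore] -/
theorem rBound_succ_le_two_pow (L : ℕ) : rBound L + 1 ≤ 2 ^ (L ^ 5 + 8) := by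
  have h := Nat.lt_two_pow_self (n := L ^ 5)
  rw [rBound, pow_add]
  have : (2 : ℕ) ^ 8 = 256 := by norm_num
  rw [this]
  omega

/-- **[AKS04, Lemma 4.3] (integer form).** For `2 ≤ n < 2 ^ L` there is a modulus
`2 ≤ r ≤ rBound L = 2 L⁵ + 8` with `r ∤ n ^ k - 1` for every `1 ≤ k ≤ L ^ 2`; in particular
`o_r(n) > L ^ 2` as soon as `n` is coprime to `r`. (Otherwise `lcm(1, …, rBound L)` divides
`∏_{k=1}^{L²} (n ^ k - 1) < 2 ^ (L⁵)`, contradicting `2 ^ m ≤ (m + 1) lcm(1, …, m)`.)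
[cite: AgrawalKayalSaxena2004, Lemma 4.3] -/
theorem exists_r_le {n L : ℕ} (hn : 2 ≤ n) (hnL : n < 2 ^ L) :
    ∃ r, 2 ≤ r ∧ r ≤ rBound L ∧ ∀ k, 0 < k → k ≤ L ^ 2 → ¬(r ∣ n ^ k - 1) := by
  by_contra h
  push Not at h
  have hL : L ≠ 0 := by
    rintro rfl
    simp at hnL
    omega
  set P := ∏ k ∈ Icc 1 (L ^ 2), (n ^ k - 1) with hP
  have hPpos : 0 < P := by
    refine Finset.prod_pos fun k hk => ?_
    have hk : k ≠ 0 := by have := (mem_Icc.mp hk).1; omega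
    have : 1 < n ^ k := Nat.one_lt_pow hk (by omega)
    omega
  -- every `r ≤ rBound L` divides `P`
  have hdvd : ∀ r ∈ Icc 1 (rBound L), (id r : ℕ) ∣ P := by
    intro r hr
    obtain ⟨hr1, hrR⟩ := mem_Icc.mp hr
    rcases eq_or_lt_of_le hr1 with h1 | hr2
    · rw [← h1]; exact one_dvd _
    · obtain ⟨k, hk0, hkL, hk⟩ := h r hr2 hrR
      exact hk.trans (Finset.dvd_prod_of_mem _ (mem_Icc.mpr ⟨hk0, hkL⟩))
  have hlcm : Nat.lcmUpto (rBound L) ≤ P :=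
    Nat.le_of_dvd hPpos (Finset.lcm_dvd hdvd)
  -- `P < 2 ^ (L ^ 5)`
  have hPle : P ≤ n ^ (L ^ 2 * L ^ 2) := by
    calc P ≤ ∏ _k ∈ Icc 1 (L ^ 2), n ^ (L ^ 2) := by
          refine Finset.prod_le_prod' fun k hk => ?_
          have hk := (mem_Icc.mp hk).2
          exact (Nat.sub_le _ _).trans (Nat.pow_le_pow_right (by omega) hk)
      _ = n ^ (L ^ 2 * L ^ 2) := by rw [prod_const, Nat.card_Icc, ← pow_mul]; simp
  have hPlt : P < 2 ^ (L ^ 5) := by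
    have h1 : n ^ (L ^ 2 * L ^ 2) < (2 ^ L) ^ (L ^ 2 * L ^ 2) :=
      Nat.pow_lt_pow_left hnL (by positivity)
    have h2 : (2 ^ L) ^ (L ^ 2 * L ^ 2) = 2 ^ (L ^ 5) := by rw [← pow_mul]; ring
    omega
  -- the lcm bound
  have h2R := Chebyshev.two_pow_le_mul_lcmUpto (rBound L)
  have hR := rBound_succ_le_two_pow L
  have key : (rBound L + 1) * Nat.lcmUpto (rBound L) < 2 ^ rBound L := by
    calc (rBound L + 1) * Nat.lcmUpto (rBound L)
        < (rBound L + 1) * 2 ^ (L ^ 5) :=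
          Nat.mul_lt_mul_of_pos_left (hlcm.trans_lt hPlt) (Nat.succ_pos _)
      _ ≤ 2 ^ (L ^ 5 + 8) * 2 ^ (L ^ 5) := Nat.mul_le_mul_right _ hR
      _ = 2 ^ rBound L := by rw [← pow_add, rBound]; ring_nf
  omega

/-- The same with remainders: some `2 ≤ r ≤ rBound L` has `n ^ k mod r ≠ 1` for all
`1 ≤ k ≤ L ^ 2` (the test performed by step 2 of the algorithm, [AKS04, §5]).
[cite: AgrawalKayalSaxena2004, Lemma 4.3] -/
theorem exists_r_le' {n L : ℕ} (hn : 2 ≤ n) (hnL : n < 2 ^ L) :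
    ∃ r, 2 ≤ r ∧ r ≤ rBound L ∧ ∀ k, 0 < k → k ≤ L ^ 2 → n ^ k % r ≠ 1 := by
  obtain ⟨r, hr2, hrR, hr⟩ := exists_r_le hn hnL
  refine ⟨r, hr2, hrR, fun k hk0 hkL hmod => hr k hk0 hkL ?_⟩
  have := Nat.dvd_sub_mod (n := r) (n ^ k)
  rwa [hmod] at this

end AKS

end Literature.NumberTheory.Primality
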